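import Literature.MathematicalPhysics.PowerSystems.DVOCStabilityCondition
import Literature.LinearAlgebra.Matrix.BorderedHessianInertia
import HarnessLib

/-!
# The dVOC decrease condition (23) as a quadratic form on the kernel of `Sᵀ`: `DecreaseOnS c` is
# EQUIVALENT to `uᵀ[(L − diag m − (α + c)I) ⊗ I₂]u ≥ 0` on `{Sᵀu = 0}`, and is therefore decided by the
# inertia of ONE bordered symmetric matrix (Groß–Colombino–Brouillon–Dörfler 2019, proof of Lemma 2)

Topic `Literature/MathematicalPhysics/PowerSystems`, namespace `Literature.MathematicalPhysics.PowerSystems.DvocReduced`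
(continues `DVOCStabilityCondition.lean`).  Written for the venture ladder GRIDFUSION (cell G2-SCALE, question Q2;
object T3 of the lead's TYPING ORDER = crux K2 «the BRIDGE» + the assembly with support P1 of idea card «idea-2 /
bordered-inertia-sync-certificate», HOME/IDEAS-G2.md sha16 8911c2c0321166ae; crit-1's reading STATUS l.10131); typed
by gridfusion-lit-4 (g14), 2026-08-28.  MODELLED column: statements about the printed REDUCED-ORDER model (17),
`M = DvocReduced N`; nothing here says a converter, feeder or grid is stable.  0 named facts, 0 kit, no `decide`.

THE PRINTED STEP.  [GrossEtAl2019, proof of Lemma 2, (40)]: «`(𝒦 − 𝓛) = (𝒦 − 𝓛)P_S`.  Thus, (23) is equivalent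
to `vᵀ(P_S 𝒦 P_S + αP_S)v ≤ vᵀP_S 𝓛 P_Sv − c‖v‖²_S` (40).  Noting that `½(K_k + K_kᵀ) = Σ_j ‖Y_jk‖(1 −
(v_j*/v_k*) cos(θ_jk*))` …».  The tree's `decreaseOnS_of_nodewise` carries this out and then ESTIMATES the two
sides; THIS FILE STOPS BEFORE THE ESTIMATES and records the equivalence itself: with `u = P_S v` (so `Sᵀu = 0`,
`‖v‖²_S = Σ_k‖u_k‖²`, `uᵀ𝒦u = Σ_k m_k‖u_k‖²`, `m_k = nodeGain k`),
`vᵀP_S(𝒦 − 𝓛 + αI)v + c‖v‖²_S = −(uᵀ𝓛u − Σ_k (m_k + α + c)‖u_k‖²) =: −h_c(u)`, and `P_S` is the identity on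
`ker Sᵀ`.  Hence `DecreaseOnS c ⟺ h_c ≥ 0 on ker Sᵀ` — the card's K2 in BOTH directions: a certificate of
`h_c ≥ 0` on `ker Sᵀ` proves (23), and a vector `u ∈ ker Sᵀ` with `h_c(u) < 0` REFUTES `DecreaseOnS c` itself.
In matrix form `h_c(u) = uᵀH(c)u` with `H(c) = (L − diag m − (α + c)I) ⊗ I₂` (block-diagonal over
`Fin N ⊕ Fin N`, `L = diag(Σ_j w_kj) − (w_kj)` the weighted graph Laplacian) and `Sᵀu = Σᵀu` for the `2N × 2`
matrix `Σ` of `sig₁, sig₂`; so by the bordered-inertia lemma (`Literature.LinearAlgebra.Matrix.BorderedHessianInertia`,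
Gould 1985 Lemma 3.4) ONE symmetric matrix `[H(c) Σ; Σᵀ 0]` with at most two negative eigenvalues and nonzero
determinant certifies (23) — the card's «In B = (2N, 2, 0) ⇒ H ≻ 0 on ker Σᵀ ⇒ (23) with margin c».

## Contents (all PROVED)
* §1 `kerForm c u` (`h_c(u)`, with `lap₁/lap₂` LITERALLY), `projS_eq_self_of_sig` (`P_S = id` on `ker Sᵀ`),
  `decrease_lhs_eq` (the identity above), **`decreaseOnS_iff_kerForm`** (both directions; `decreaseOnS_of_kerForm`,
  `kerForm_nonneg_of_decreaseOnS`, `not_decreaseOnS_of_witness`).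
* §2 matrix form: `toVec u = Sum.elim u.1 u.2`, `lapMatrix`, `hMatrix c = fromBlocks M 0 0 M` with
  `M = lapMatrix − diagonal(m + α + c)`, `sigMatrix` (`2N × 2`); `lapMatrix_mulVec` (`(Lx)_k = Σ_j w_kj(x_k − x_j)`),
  `toVec_hMatrix_toVec` (`uᵀH(c)u = h_c(u)`), `sigMatrix_transpose_mulVec_zero/_one/_eq_zero_iff`
  (`Σᵀu = (sig₁ u, sig₂ u)`),
  `isHermitian_hMatrix` (symmetric weights).
* §3 **`decreaseOnS_of_borderedInertia`**: `#{i | λ_i([H(c) Σ; Σᵀ 0]) < 0} ≤ 2` and `det ≠ 0` ⇒ `DecreaseOnS c`;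
  **`decreaseOnS_of_borderedNonposCount`**: `#{i | λ_i([H(c) Σ; Σᵀ 0]) ≤ 0} ≤ 2` ⇒ `DecreaseOnS c` (round-down
  certificate form, no determinant);
  **`decreaseOnS_of_shiftedBorderedNegIndex`**: `δ > 0` and `#{i | λ_i([H(c) Σ; Σᵀ −δI₂]) < 0} ≤ 2` ⇒
  `DecreaseOnS c` (the form a sparse negative-index certificate feeds; no determinant).
* §4 WEIGHT-PERTURBATION TRANSFER (admittance weights `‖Y_kj‖ = (r²+x²)^{-1/2}` are irrational; certificates
  run on a rational bracket record `W̃` with the same `θ, v*, α`): `kerForm_add`, `sig_eq_of_same_setpoints`,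
  `kerForm_sub_kerForm` (the difference is linear in `w − w̃`), `abs_kerForm_sub_le`
  (`|h_c(u;w) − h_c(u;w̃)| ≤ (3 + ρ)·d·Σ‖u_k‖²` for `Σ_j|w_kj − w̃_kj| ≤ d`, `v_j*/v_k* ≤ ρ`, both symmetric),
  **`kerForm_ge_of_weights_close`** (`h_{c+(3+ρ)d}(u; w̃) ≤ h_c(u; w)`), **`decreaseOnS_of_kerForm_close`**
  (a kernel-form certificate for `W̃` at margin `c + (3+ρ)d` ⇒ `W.DecreaseOnS c` for the exact record).
* §5 GENERIC BLOCK (append): the three doors for ANY symmetric `B` representing a form `Φ` on `Fin N ⊕ Fin N`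
  (`nonneg_on_kerSig_of_borderedNonposCount / _of_borderedInertia / _of_shiftedBorderedNegIndex`) and
  `decreaseOnS_of_block_le_kerForm` (a dominated block passing a test ⇒ (23)) — for rotated-coupling variants.
THREE COLUMNS: no certificate here (an instance's exact factorisation / pivot count is Bench data: the tree's
`SylvesterInertiaLDL.card_eigenvalues_lt_eq_card_neg_pivots` turns it into `hneg`, a nonzero pivot product into
`hdet`); VALIDATED nothing; MODELLED = model `M` (uniform `ℓ/r`, Kron-reduced quasi-steady lines, consistent
set-points); the instance's `m = nodeGain` is Kron-derived data (card P4).  Sources: [cite: GrossEtAl2019, Lemma 2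
and its proof (40)–(41)] (arXiv:1802.08881 p0011, read through the tree file's quotations); [cite: ColombinoEtAl2019,
Prop. 7]; [cite: Gould1985, Lemma 3.4] via the tree.
-/

noncomputable section

namespace Literature.MathematicalPhysics.PowerSystems

open Real Finset Matrix

namespace DvocReduced

variable {N : ℕ} (W : DvocReduced N)

/-! ## §1 The decrease condition as a form on `ker Sᵀ` -/

/-- THE KERNEL FORM `h_c(u) = uᵀ𝓛u − Σ_k (m_k + α + c)‖u_k‖²`, `uᵀ𝓛u = Σ_k (u_k¹(𝓛u)_k¹ + u_k²(𝓛u)_k²)` with the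
tree's `lap₁`, `lap₂` literally (`𝓛 = L ⊗ I₂`) and `m_k = nodeGain k`: the quadratic form of
`H(c) = (L − diag m − (α + c)I) ⊗ I₂`. [cite: GrossEtAl2019, proof of Lemma 2 (40)–(41)] -/
def kerForm (c : ℝ) (u : DvocState N) : ℝ :=
  ∑ k, (u.1 k * W.lap₁ u k + u.2 k * W.lap₂ u k) - ∑ k, (W.nodeGain k + W.α + c) * dvocNsq u k

/-- `P_S` is the identity on `ker Sᵀ`: `sig₁ u = sig₂ u = 0 ⇒ P_S u = u`. [cite: GrossEtAl2019, §IV-D] -/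
theorem projS_eq_self_of_sig {u : DvocState N} (h1 : W.sig₁ u = 0) (h2 : W.sig₂ u = 0) : W.projS u = u := by
  have h0 : W.embS (W.sig₁ u / W.Lam) (W.sig₂ u / W.Lam) = 0 := by
    rw [h1, h2, zero_div]
    ext k <;> simp [embS]
  rw [projS, h0, sub_zero]

/-- **THE IDENTITY BEHIND (40)**: for every `v`, with `u = P_S v`,
`vᵀP_S e_θ(v) + α‖v‖²_S + c‖v‖²_S = −h_c(u)` (all `v_k* > 0`): `(𝒦 − 𝓛) = (𝒦 − 𝓛)P_S`, `uᵀ𝒦u = Σ m_k‖u_k‖²`,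
`‖v‖²_S = Σ‖u_k‖²`. [cite: GrossEtAl2019, proof of Lemma 2 (40)–(41)]; [cite: ColombinoEtAl2019, Prop. 7] -/
theorem decrease_lhs_eq [NeZero N] (hv : ∀ k, 0 < W.vref k) (c : ℝ) (v : DvocState N) :
    W.qS v (W.eθ v) + W.α * W.normS2 v + c * W.normS2 v = -W.kerForm c (W.projS v) := by
  have hΛ : W.Lam ≠ 0 := (W.Lam_pos hv).ne'
  have hne : ∀ k, W.vref k ≠ 0 := fun k => (hv k).ne'
  set u := W.projS v with hu
  have hS : W.normS2 v = ∑ k, dvocNsq u k := W.normS2_eq_sum_nsq_projS hΛ v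
  have hq : W.qS v (W.eθ v) = ∑ k, (u.1 k * W.Kang₁ u k + u.2 k * W.Kang₂ u k)
      - ∑ k, (u.1 k * W.lap₁ u k + u.2 k * W.lap₂ u k) := by
    rw [W.qS_eq_dot_projS, ← hu, dvocDot, ← Finset.sum_sub_distrib]
    refine Finset.sum_congr rfl fun k _ => ?_
    obtain ⟨e1, e2⟩ := W.eθ_projS hne v k
    have h1 : (W.eθ v).1 k = W.Kang₁ u k - W.lap₁ u k := by
      simp only [eθ]; rw [← e1, W.eθ₁_eq_K_sub_lap]
    have h2 : (W.eθ v).2 k = W.Kang₂ u k - W.lap₂ u k := by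
      simp only [eθ]; rw [← e2, W.eθ₂_eq_K_sub_lap]
    rw [h1, h2]; ring
  rw [hq, W.dot_Kang, hS, kerForm]
  simp only [Finset.mul_sum, ← Finset.sum_add_distrib, ← Finset.sum_sub_distrib, ← Finset.sum_neg_distrib]
  exact Finset.sum_congr rfl fun k _ => by ring

/-- **K2, direction «→»**: if `h_c(u) ≥ 0` for every `u` with `Sᵀu = 0`, then the decrease inequality (23) holds
with margin `c` (`W.DecreaseOnS c`). [cite: GrossEtAl2019, Lemma 2 and its proof (40)] -/
theorem decreaseOnS_of_kerForm [NeZero N] (hv : ∀ k, 0 < W.vref k) {c : ℝ}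
    (h : ∀ u : DvocState N, W.sig₁ u = 0 → W.sig₂ u = 0 → 0 ≤ W.kerForm c u) : W.DecreaseOnS c := by
  have hΛ : W.Lam ≠ 0 := (W.Lam_pos hv).ne'
  intro v
  have hid := W.decrease_lhs_eq hv c v
  obtain ⟨h1, h2⟩ := W.sig_projS hΛ v
  have := h (W.projS v) h1 h2
  linarith

/-- **K2, direction «←»**: (23) with margin `c` forces `h_c(u) ≥ 0` on `ker Sᵀ` (take `v = u`, `P_S u = u`).
[cite: GrossEtAl2019, Lemma 2 and its proof (40)] -/
theorem kerForm_nonneg_of_decreaseOnS [NeZero N] (hv : ∀ k, 0 < W.vref k) {c : ℝ} (h : W.DecreaseOnS c)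
    {u : DvocState N} (h1 : W.sig₁ u = 0) (h2 : W.sig₂ u = 0) : 0 ≤ W.kerForm c u := by
  have hid := W.decrease_lhs_eq hv c u
  rw [W.projS_eq_self_of_sig h1 h2] at hid
  have := h u
  linarith

/-- **K2, THE BRIDGE (both directions)**: `DecreaseOnS c ⟺ ∀ u, Sᵀu = 0 → 0 ≤ h_c(u)`.
[cite: GrossEtAl2019, Lemma 2 and its proof (40)–(41)] -/
theorem decreaseOnS_iff_kerForm [NeZero N] (hv : ∀ k, 0 < W.vref k) (c : ℝ) :
    W.DecreaseOnS c ↔ ∀ u : DvocState N, W.sig₁ u = 0 → W.sig₂ u = 0 → 0 ≤ W.kerForm c u :=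
  ⟨fun h _ h1 h2 => W.kerForm_nonneg_of_decreaseOnS hv h h1 h2, W.decreaseOnS_of_kerForm hv⟩

/-- **A NO-WITNESS REFUTES (23) ITSELF**: a vector `u` with `Sᵀu = 0` and `h_c(u) < 0` (e.g. a rational `u` checked
by one sparse product) shows `¬ DecreaseOnS c` — the hypothesis `hdec` of the Prop. 3 / Thm 2 chain, not merely
«Condition 2 infeasible». [cite: GrossEtAl2019, Lemma 2] -/
theorem not_decreaseOnS_of_witness [NeZero N] (hv : ∀ k, 0 < W.vref k) {c : ℝ} {u : DvocState N}
    (h1 : W.sig₁ u = 0) (h2 : W.sig₂ u = 0) (hneg : W.kerForm c u < 0) : ¬ W.DecreaseOnS c :=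
  fun h => absurd (W.kerForm_nonneg_of_decreaseOnS hv h h1 h2) (not_le.mpr hneg)

/-! ## §2 Matrix form over `Fin N ⊕ Fin N` -/

/-- A state `u = (u¹, u²) ∈ ℝ^N × ℝ^N` as one vector on `Fin N ⊕ Fin N` (first all `u¹`, then all `u²`). [folklore] -/
def toVec (u : DvocState N) : Fin N ⊕ Fin N → ℝ := Sum.elim u.1 u.2

/-- THE WEIGHTED GRAPH LAPLACIAN `L = diag(Σ_j w_kj) − (w_kj)` of the coupling weights (`(Lx)_k = Σ_j w_kj(x_k − x_j)`
whatever the diagonal of `w`). [cite: GrossEtAl2019, §II-B] («`L = B diag(‖Y_l‖) Bᵀ`») -/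
def lapMatrix : Matrix (Fin N) (Fin N) ℝ := Matrix.diagonal (fun k => ∑ j, W.w k j) - Matrix.of W.w

/-- The `N × N` block `M(c) = L − diag(m_k + α + c)`. [cite: GrossEtAl2019, proof of Lemma 2 (40)–(41)] -/
def hBlock (c : ℝ) : Matrix (Fin N) (Fin N) ℝ :=
  W.lapMatrix - Matrix.diagonal (fun k => W.nodeGain k + W.α + c)

/-- `H(c) = M(c) ⊗ I₂ = [M(c) 0; 0 M(c)]` on `Fin N ⊕ Fin N`. [cite: GrossEtAl2019, proof of Lemma 2 (40)–(41)] -/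
def hMatrix (c : ℝ) : Matrix (Fin N ⊕ Fin N) (Fin N ⊕ Fin N) ℝ :=
  Matrix.fromBlocks (W.hBlock c) 0 0 (W.hBlock c)

/-- THE `2N × 2` MATRIX `Σ` whose transpose acts as `u ↦ (sig₁ u, sig₂ u)` (columns `v_k*R(θ_k)`).
[cite: GrossEtAl2019, §IV-D] (`S := [v_1* R(θ_11*)ᵀ … v_N* R(θ_1N*)ᵀ]ᵀ`) -/
def sigMatrix : Matrix (Fin N ⊕ Fin N) (Fin 2) ℝ :=
  Matrix.of fun r => Sum.elim (fun k => ![W.vref k * cos (W.θ k), -(W.vref k * sin (W.θ k))])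
    (fun k => ![W.vref k * sin (W.θ k), W.vref k * cos (W.θ k)]) r

/-- `(Lx)_k = Σ_j w_kj (x_k − x_j)` — the tree's `lap₁/lap₂` componentwise. [cite: GrossEtAl2019, §II-B] -/
theorem lapMatrix_mulVec (x : Fin N → ℝ) (k : Fin N) :
    (W.lapMatrix *ᵥ x) k = ∑ j, W.w k j * (x k - x j) := by
  rw [lapMatrix, Matrix.sub_mulVec, Pi.sub_apply, Matrix.mulVec_diagonal]
  have h : (Matrix.of W.w *ᵥ x) k = ∑ j, W.w k j * x j := rfl
  rw [h, Finset.sum_mul, ← Finset.sum_sub_distrib]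
  exact Finset.sum_congr rfl fun j _ => by ring

/-- `(M(c)x)_k = Σ_j w_kj(x_k − x_j) − (m_k + α + c)x_k`. [cite: GrossEtAl2019, proof of Lemma 2 (40)–(41)] -/
theorem hBlock_mulVec (c : ℝ) (x : Fin N → ℝ) (k : Fin N) :
    (W.hBlock c *ᵥ x) k = ∑ j, W.w k j * (x k - x j) - (W.nodeGain k + W.α + c) * x k := by
  simp only [hBlock, Matrix.sub_mulVec, Pi.sub_apply, Matrix.mulVec_diagonal, W.lapMatrix_mulVec]

/-- **`uᵀH(c)u = h_c(u)`**: the matrix `H(c)` represents the kernel form (with `lap₁/lap₂` literally).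
[cite: GrossEtAl2019, proof of Lemma 2 (40)–(41)] -/
theorem toVec_hMatrix_toVec (c : ℝ) (u : DvocState N) :
    toVec u ⬝ᵥ W.hMatrix c *ᵥ toVec u = W.kerForm c u := by
  rw [hMatrix, toVec, Matrix.fromBlocks_mulVec]
  simp only [Sum.elim_comp_inl, Sum.elim_comp_inr, Matrix.zero_mulVec, add_zero, zero_add]
  rw [sumElim_dotProduct_sumElim]
  simp only [dotProduct, W.hBlock_mulVec, kerForm, lap₁, lap₂, dvocNsq, ← Finset.sum_add_distrib,
    ← Finset.sum_sub_distrib]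
  exact Finset.sum_congr rfl fun k _ => by ring

/-- **`(Σᵀu)₁ = sig₁ u`**. [cite: GrossEtAl2019, §IV-D] -/
theorem sigMatrix_transpose_mulVec_zero (u : DvocState N) :
    ((W.sigMatrix)ᵀ *ᵥ toVec u) 0 = W.sig₁ u := by
  simp only [Matrix.mulVec, dotProduct, Matrix.transpose_apply, toVec, Fintype.sum_sum_type, Sum.elim_inl,
    Sum.elim_inr, sigMatrix, Matrix.of_apply, Matrix.cons_val_zero, sig₁, ← Finset.sum_add_distrib]
  exact Finset.sum_congr rfl fun k _ => by ring

/-- **`(Σᵀu)₂ = sig₂ u`**. [cite: GrossEtAl2019, §IV-D] -/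
theorem sigMatrix_transpose_mulVec_one (u : DvocState N) :
    ((W.sigMatrix)ᵀ *ᵥ toVec u) 1 = W.sig₂ u := by
  simp only [Matrix.mulVec, dotProduct, Matrix.transpose_apply, toVec, Fintype.sum_sum_type, Sum.elim_inl,
    Sum.elim_inr, sigMatrix, Matrix.of_apply, Matrix.cons_val_one, Matrix.cons_val_zero, sig₂,
    ← Finset.sum_add_distrib]
  exact Finset.sum_congr rfl fun k _ => by ring

/-- `Σᵀu = 0 ⟺ sig₁ u = 0 ∧ sig₂ u = 0`. [cite: GrossEtAl2019, §IV-D] -/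
theorem sigMatrix_transpose_mulVec_eq_zero_iff (u : DvocState N) :
    (W.sigMatrix)ᵀ *ᵥ toVec u = 0 ↔ W.sig₁ u = 0 ∧ W.sig₂ u = 0 := by
  constructor
  · intro h
    exact ⟨by rw [← W.sigMatrix_transpose_mulVec_zero u, h, Pi.zero_apply],
      by rw [← W.sigMatrix_transpose_mulVec_one u, h, Pi.zero_apply]⟩
  · rintro ⟨h1, h2⟩
    funext c
    fin_cases c
    · simpa using (W.sigMatrix_transpose_mulVec_zero u).trans h1
    · simpa using (W.sigMatrix_transpose_mulVec_one u).trans h2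

/-- `L` is symmetric for symmetric weights. [cite: GrossEtAl2019, §II-B] -/
theorem isHermitian_lapMatrix (hsym : ∀ k j, W.w k j = W.w j k) : W.lapMatrix.IsHermitian := by
  rw [Matrix.IsHermitian, Matrix.conjTranspose_eq_transpose_of_trivial]
  ext k j
  simp only [lapMatrix, Matrix.transpose_apply, Matrix.sub_apply, Matrix.diagonal_apply, Matrix.of_apply]
  by_cases h : k = j
  · subst h; simp
  · rw [if_neg h, if_neg (Ne.symm h), hsym j k]

/-- `H(c)` is symmetric for symmetric weights. [cite: GrossEtAl2019, proof of Lemma 2 (40)–(41)] -/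
theorem isHermitian_hMatrix (hsym : ∀ k j, W.w k j = W.w j k) (c : ℝ) : (W.hMatrix c).IsHermitian := by
  have hM : (W.hBlock c).IsHermitian := by
    have h1 := W.isHermitian_lapMatrix hsym
    have h2 : (Matrix.diagonal (fun k => W.nodeGain k + W.α + c)).IsHermitian := by
      rw [Matrix.IsHermitian, Matrix.conjTranspose_eq_transpose_of_trivial, Matrix.diagonal_transpose]
    exact h1.sub h2
  refine Matrix.IsHermitian.fromBlocks hM ?_ hM
  simp

/-! ## §3 The bordered-inertia certificate decides (23) -/

/-- **BORDERED INERTIA DECIDES THE DECREASE CONDITION (23)** (card idea-2: «In B = (2N, 2, 0) ⇒ H ≻ 0 on ker Σᵀ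
⇒ (23) with margin c»): for symmetric weights and `v_k* > 0`, if the bordered symmetric matrix
`[H(c) Σ; Σᵀ 0]` on `(Fin N ⊕ Fin N) ⊕ Fin 2` has AT MOST TWO negative eigenvalues and nonzero determinant, then
`W.DecreaseOnS c`.  The two hypotheses are what one exact symmetric elimination (`LDLᵀ` with the two border
rows last) delivers through `SylvesterInertiaLDL.card_eigenvalues_lt_eq_card_neg_pivots`; they are the ONLY
inputs that are not nodewise or edgewise inequalities of the Prop. 3 / Thm 2 chain.  MODELLED: model `M`; nothing about a real feeder.
[cite: GrossEtAl2019, Lemma 2 (23) and its proof (40)–(41)]; [cite: Gould1985, Lemma 3.4] (via the tree) -/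
theorem decreaseOnS_of_borderedInertia [NeZero N] (hv : ∀ k, 0 < W.vref k) (c : ℝ)
    (hK : (Matrix.fromBlocks (W.hMatrix c) W.sigMatrix (W.sigMatrix)ᵀ (0 : Matrix (Fin 2) (Fin 2) ℝ)).IsHermitian)
    (hneg : (univ.filter fun i => hK.eigenvalues i < 0).card ≤ 2)
    (hdet : (Matrix.fromBlocks (W.hMatrix c) W.sigMatrix (W.sigMatrix)ᵀ (0 : Matrix (Fin 2) (Fin 2) ℝ)).det ≠ 0) :
    W.DecreaseOnS c := by
  refine W.decreaseOnS_of_kerForm hv fun u h1 h2 => ?_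
  have hker : (W.sigMatrix)ᵀ *ᵥ toVec u = 0 := (W.sigMatrix_transpose_mulVec_eq_zero_iff u).2 ⟨h1, h2⟩
  have h := Literature.LinearAlgebra.Matrix.BorderedHessianInertia.nonneg_on_ker_of_bordered_inertia
    W.sigMatrix hK (by simpa using hneg) hdet (toVec u) hker
  rwa [W.toVec_hMatrix_toVec] at h

/-- **THE ROUND-DOWN-CERTIFICATE FORM (no determinant, nonpositive count)**: for symmetric weights and `v_k* > 0`,
if the bordered symmetric matrix `[H(c) Σ; Σᵀ 0]` has AT MOST TWO eigenvalues `≤ 0`, then `W.DecreaseOnS c` — the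
hypothesis a rounded factorisation `K ⪰ LDLᵀ` (two negative pivots, all others positive; Sylvester + Weyl) delivers.
MODELLED: model `M`. [cite: GrossEtAl2019, Lemma 2 (23) and its proof (40)–(41)]; [cite: Gould1985, Lemma 3.4] (via the tree) -/
theorem decreaseOnS_of_borderedNonposCount [NeZero N] (hv : ∀ k, 0 < W.vref k) (c : ℝ)
    (hK : (Matrix.fromBlocks (W.hMatrix c) W.sigMatrix (W.sigMatrix)ᵀ (0 : Matrix (Fin 2) (Fin 2) ℝ)).IsHermitian)
    (hle : (univ.filter fun i => hK.eigenvalues i ≤ 0).card ≤ 2) :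
    W.DecreaseOnS c := by
  refine W.decreaseOnS_of_kerForm hv fun u h1 h2 => ?_
  have hker : (W.sigMatrix)ᵀ *ᵥ toVec u = 0 := (W.sigMatrix_transpose_mulVec_eq_zero_iff u).2 ⟨h1, h2⟩
  by_cases hu : toVec u = 0
  · have h0 : W.kerForm c u = 0 := by
      rw [← W.toVec_hMatrix_toVec, hu]; simp
    rw [h0]
  · have h := Literature.LinearAlgebra.Matrix.BorderedHessianInertia.posDef_on_ker_of_bordered_nonposCount
      W.sigMatrix hK (by simpa using hle) (toVec u) hker hu
    rw [W.toVec_hMatrix_toVec] at h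
    exact h.le

/-- **THE SPARSE-CERTIFICATE FORM (no determinant)**: for symmetric weights and `v_k* > 0`, if for some `δ > 0`
the symmetric matrix `[H(c) Σ; Σᵀ −δI₂]` has AT MOST TWO negative eigenvalues, then `W.DecreaseOnS c`.  This is
the hypothesis a clique-sum / exact-elimination NEGATIVE-INDEX bound delivers (`#neg(Σ_c P_cᵀS_cP_c) ≤ Σ_c #neg(S_c)`
with exactly two negative rank-one terms), with no nonsingularity side condition; by Finsler's lemma such a `δ`
exists whenever `H(c) ≻ 0` on `ker Σᵀ ∖ {0}`.  MODELLED: model `M`.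
[cite: GrossEtAl2019, Lemma 2 (23) and its proof (40)–(41)]; [cite: Gould1985, Lemma 3.4] (via the tree) -/
theorem decreaseOnS_of_shiftedBorderedNegIndex [NeZero N] (hv : ∀ k, 0 < W.vref k) (c : ℝ) {δ : ℝ}
    (hδ : 0 < δ)
    (hK : (Matrix.fromBlocks (W.hMatrix c) W.sigMatrix (W.sigMatrix)ᵀ
      (-(δ • (1 : Matrix (Fin 2) (Fin 2) ℝ)))).IsHermitian)
    (hneg : (univ.filter fun i => hK.eigenvalues i < 0).card ≤ 2) :
    W.DecreaseOnS c := by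
  refine W.decreaseOnS_of_kerForm hv fun u h1 h2 => ?_
  have hker : (W.sigMatrix)ᵀ *ᵥ toVec u = 0 := (W.sigMatrix_transpose_mulVec_eq_zero_iff u).2 ⟨h1, h2⟩
  have h := Literature.LinearAlgebra.Matrix.BorderedHessianInertia.nonneg_on_ker_of_shiftedBordered_negIndex
    W.sigMatrix hδ hK (by simpa using hneg) (toVec u) hker
  rwa [W.toVec_hMatrix_toVec] at h

/-! ## §4 Weight-perturbation transfer: a certificate for RATIONAL bracket weights `w̃` serves the exact record -/

/-- `h_{c+t}(u) = h_c(u) − t·Σ_k‖u_k‖²`. [cite: GrossEtAl2019, proof of Lemma 2 (40)–(41)] -/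
theorem kerForm_add (c t : ℝ) (u : DvocState N) :
    W.kerForm (c + t) u = W.kerForm c u - t * ∑ k, dvocNsq u k := by
  have h : ∑ k, (W.nodeGain k + W.α + (c + t)) * dvocNsq u k
      = ∑ k, (W.nodeGain k + W.α + c) * dvocNsq u k + t * ∑ k, dvocNsq u k := by
    rw [Finset.mul_sum, ← Finset.sum_add_distrib]
    exact Finset.sum_congr rfl fun k _ => by ring
  rw [kerForm, kerForm, h]
  ring

/-- `Sᵀ` depends only on the set-points: two records with the same `θ`, `v*` have the same `sig₁`, `sig₂`.
[cite: GrossEtAl2019, §IV-D] -/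
theorem sig_eq_of_same_setpoints (W' : DvocReduced N) (hθ : W'.θ = W.θ) (hv : W'.vref = W.vref)
    (u : DvocState N) : W'.sig₁ u = W.sig₁ u ∧ W'.sig₂ u = W.sig₂ u := by
  refine ⟨?_, ?_⟩ <;> simp only [sig₁, sig₂, hθ, hv]

/-- THE DIFFERENCE OF TWO KERNEL FORMS with the same set-points and gain is linear in the weight difference:
`h_c(u; w) − h_c(u; w̃) = Σ_k Σ_j (w_kj − w̃_kj)·(⟨u_k, u_k − u_j⟩ − (1 − (v_j*/v_k*) cos θ_jk)‖u_k‖²)`.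
[cite: GrossEtAl2019, proof of Lemma 2 (40)–(41)] (both forms are linear in the weights) -/
theorem kerForm_sub_kerForm (W' : DvocReduced N) (hθ : W'.θ = W.θ) (hv : W'.vref = W.vref) (hα : W'.α = W.α)
    (c : ℝ) (u : DvocState N) :
    W.kerForm c u - W'.kerForm c u
      = ∑ k, ∑ j, (W.w k j - W'.w k j) *
          (u.1 k * (u.1 k - u.1 j) + u.2 k * (u.2 k - u.2 j)
            - (1 - W.vref j / W.vref k * cos (W.θ j - W.θ k)) * dvocNsq u k) := by
  have hlap1 : ∀ k, W.lap₁ u k - W'.lap₁ u k = ∑ j, (W.w k j - W'.w k j) * (u.1 k - u.1 j) := by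
    intro k; simp only [lap₁, ← Finset.sum_sub_distrib, sub_mul]
  have hlap2 : ∀ k, W.lap₂ u k - W'.lap₂ u k = ∑ j, (W.w k j - W'.w k j) * (u.2 k - u.2 j) := by
    intro k; simp only [lap₂, ← Finset.sum_sub_distrib, sub_mul]
  have hm : ∀ k, W.nodeGain k - W'.nodeGain k
      = ∑ j, (W.w k j - W'.w k j) * (1 - W.vref j / W.vref k * cos (W.θ j - W.θ k)) := by
    intro k; simp only [nodeGain, hθ, hv, ← Finset.sum_sub_distrib, sub_mul]
  have hstep : W.kerForm c u - W'.kerForm c u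
      = ∑ k, (u.1 k * (W.lap₁ u k - W'.lap₁ u k) + u.2 k * (W.lap₂ u k - W'.lap₂ u k)
          - (W.nodeGain k - W'.nodeGain k) * dvocNsq u k) := by
    simp only [kerForm, hα]
    rw [show ∀ a b c' d' : ℝ, (a - c') - (b - d') = (a - b) - (c' - d') from fun _ _ _ _ => by ring,
      ← Finset.sum_sub_distrib, ← Finset.sum_sub_distrib, ← Finset.sum_sub_distrib]
    exact Finset.sum_congr rfl fun k _ => by ring
  rw [hstep]
  refine Finset.sum_congr rfl fun k _ => ?_
  rw [hlap1, hlap2, hm, Finset.mul_sum, Finset.mul_sum, Finset.sum_mul, ← Finset.sum_add_distrib,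
    ← Finset.sum_sub_distrib]
  exact Finset.sum_congr rfl fun j _ => by ring

/-- THE ROW-SUM (GERSHGORIN-TYPE) BOUND ON THE DIFFERENCE: for symmetric weights `w`, `w̃` with
`Σ_j |w_kj − w̃_kj| ≤ d` for every `k`, positive set-points with `v_j*/v_k* ≤ ρ`, and the same `θ`, `v*`, `α`:
`|h_c(u; w) − h_c(u; w̃)| ≤ (3 + ρ)·d·Σ_k‖u_k‖²` (`|⟨u_k, u_k − u_j⟩| ≤ (3/2)‖u_k‖² + ½‖u_j‖²`,
`|1 − (v_j*/v_k*) cos θ_jk| ≤ 1 + ρ`, column sums by symmetry). [cite: GrossEtAl2019, proof of Prop. 2]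
(the printed row-sum estimate «‖𝓛‖ = ‖L‖ ≤ 2 max_k Σ_j ‖Y_jk‖», here for the weight DIFFERENCE) -/
theorem abs_kerForm_sub_le [NeZero N] (W' : DvocReduced N) (hθ : W'.θ = W.θ) (hv : W'.vref = W.vref) (hα : W'.α = W.α)
    (hsym : ∀ k j, W.w k j = W.w j k) (hsym' : ∀ k j, W'.w k j = W'.w j k) (hvpos : ∀ k, 0 < W.vref k)
    {d ρ : ℝ} (hd : ∀ k, ∑ j, |W.w k j - W'.w k j| ≤ d) (hρ : ∀ j k, W.vref j / W.vref k ≤ ρ)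
    (c : ℝ) (u : DvocState N) :
    |W.kerForm c u - W'.kerForm c u| ≤ (3 + ρ) * d * ∑ k, dvocNsq u k := by
  rw [W.kerForm_sub_kerForm W' hθ hv hα c u]
  have hn : ∀ k, 0 ≤ dvocNsq u k := fun k => by unfold dvocNsq; positivity
  -- (1) the pointwise bound on the bracket
  have hX : ∀ k j, |u.1 k * (u.1 k - u.1 j) + u.2 k * (u.2 k - u.2 j)
        - (1 - W.vref j / W.vref k * cos (W.θ j - W.θ k)) * dvocNsq u k|
      ≤ (5 / 2 + ρ) * dvocNsq u k + 1 / 2 * dvocNsq u j := by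
    intro k j
    have hr : 0 ≤ W.vref j / W.vref k := (div_pos (hvpos j) (hvpos k)).le
    have hrρ : W.vref j / W.vref k ≤ ρ := hρ j k
    have hcos : |cos (W.θ j - W.θ k)| ≤ 1 := abs_cos_le_one _
    have hg : |1 - W.vref j / W.vref k * cos (W.θ j - W.θ k)| ≤ 1 + ρ := by
      calc |1 - W.vref j / W.vref k * cos (W.θ j - W.θ k)|
          ≤ |(1 : ℝ)| + |W.vref j / W.vref k * cos (W.θ j - W.θ k)| := abs_sub _ _
        _ ≤ 1 + ρ := by
          rw [abs_one, abs_mul, abs_of_nonneg hr]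
          have := mul_le_mul hrρ hcos (abs_nonneg _) (le_trans hr hrρ)
          linarith
    have h1 : |u.1 k * (u.1 k - u.1 j) + u.2 k * (u.2 k - u.2 j)|
        ≤ 3 / 2 * dvocNsq u k + 1 / 2 * dvocNsq u j := by
      rw [abs_le, dvocNsq, dvocNsq]
      constructor
      · nlinarith [sq_nonneg (u.1 k - u.1 j), sq_nonneg (u.2 k - u.2 j), sq_nonneg (u.1 k), sq_nonneg (u.2 k)]
      · nlinarith [sq_nonneg (u.1 k + u.1 j), sq_nonneg (u.2 k + u.2 j)]
    have h2 : |(1 - W.vref j / W.vref k * cos (W.θ j - W.θ k)) * dvocNsq u k| ≤ (1 + ρ) * dvocNsq u k := by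
      rw [abs_mul, abs_of_nonneg (hn k)]
      exact mul_le_mul_of_nonneg_right hg (hn k)
    calc _ ≤ |u.1 k * (u.1 k - u.1 j) + u.2 k * (u.2 k - u.2 j)|
          + |(1 - W.vref j / W.vref k * cos (W.θ j - W.θ k)) * dvocNsq u k| := abs_sub _ _
      _ ≤ (3 / 2 * dvocNsq u k + 1 / 2 * dvocNsq u j) + (1 + ρ) * dvocNsq u k := add_le_add h1 h2
      _ = (5 / 2 + ρ) * dvocNsq u k + 1 / 2 * dvocNsq u j := by ring
  -- (2) row sums and, by symmetry, column sums of `|w − w̃|` are `≤ d`; `5/2 + ρ ≥ 0`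
  have hcol : ∀ j, ∑ k, |W.w k j - W'.w k j| ≤ d := by
    intro j
    have : ∑ k, |W.w k j - W'.w k j| = ∑ k, |W.w j k - W'.w j k| :=
      Finset.sum_congr rfl fun k _ => by rw [hsym k j, hsym' k j]
    rw [this]; exact hd j
  have hρ0 : 0 ≤ 5 / 2 + ρ := by
    have := hρ (0 : Fin N) 0
    rw [div_self (hvpos 0).ne'] at this
    linarith
  -- (3) assemble
  have hsplit : ∑ k, ∑ j, |W.w k j - W'.w k j| * ((5 / 2 + ρ) * dvocNsq u k + 1 / 2 * dvocNsq u j)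
      = ∑ k, (5 / 2 + ρ) * dvocNsq u k * ∑ j, |W.w k j - W'.w k j|
        + ∑ j, 1 / 2 * dvocNsq u j * ∑ k, |W.w k j - W'.w k j| := by
    have h1 : ∀ k, ∑ j, |W.w k j - W'.w k j| * ((5 / 2 + ρ) * dvocNsq u k + 1 / 2 * dvocNsq u j)
        = (5 / 2 + ρ) * dvocNsq u k * ∑ j, |W.w k j - W'.w k j|
          + ∑ j, 1 / 2 * dvocNsq u j * |W.w k j - W'.w k j| := by
      intro k
      rw [Finset.mul_sum, ← Finset.sum_add_distrib]
      exact Finset.sum_congr rfl fun j _ => by ring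
    simp only [h1, Finset.sum_add_distrib]
    congr 1
    rw [Finset.sum_comm]
    exact Finset.sum_congr rfl fun j _ => by rw [Finset.mul_sum]
  calc |∑ k, ∑ j, (W.w k j - W'.w k j) * (u.1 k * (u.1 k - u.1 j) + u.2 k * (u.2 k - u.2 j)
          - (1 - W.vref j / W.vref k * cos (W.θ j - W.θ k)) * dvocNsq u k)|
      ≤ ∑ k, ∑ j, |W.w k j - W'.w k j| * ((5 / 2 + ρ) * dvocNsq u k + 1 / 2 * dvocNsq u j) := by
        refine (Finset.abs_sum_le_sum_abs _ _).trans (Finset.sum_le_sum fun k _ => ?_)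
        refine (Finset.abs_sum_le_sum_abs _ _).trans (Finset.sum_le_sum fun j _ => ?_)
        rw [abs_mul]
        exact mul_le_mul_of_nonneg_left (hX k j) (abs_nonneg _)
    _ = ∑ k, (5 / 2 + ρ) * dvocNsq u k * ∑ j, |W.w k j - W'.w k j|
        + ∑ j, 1 / 2 * dvocNsq u j * ∑ k, |W.w k j - W'.w k j| := hsplit
    _ ≤ ∑ k, (5 / 2 + ρ) * dvocNsq u k * d + ∑ j, 1 / 2 * dvocNsq u j * d := by
        refine add_le_add (Finset.sum_le_sum fun k _ => ?_) (Finset.sum_le_sum fun j _ => ?_)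
        · exact mul_le_mul_of_nonneg_left (hd k) (mul_nonneg hρ0 (hn k))
        · exact mul_le_mul_of_nonneg_left (hcol j) (by linarith [hn j])
    _ = (3 + ρ) * d * ∑ k, dvocNsq u k := by
        rw [Finset.mul_sum, ← Finset.sum_add_distrib]
        exact Finset.sum_congr rfl fun k _ => by ring

/-- **WEIGHT-PERTURBATION TRANSFER**: under the hypotheses of `abs_kerForm_sub_le`,
`h_{c + (3+ρ)d}(u; w̃) ≤ h_c(u; w)` for every `u` — a kernel-form certificate for the RATIONAL bracket record
`W̃` at margin `c + (3 + ρ)·d` is a certificate for the exact-weight record `W` at margin `c`.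
[cite: GrossEtAl2019, proof of Lemma 2 (40)–(41) and proof of Prop. 2 (row-sum estimate)] -/
theorem kerForm_ge_of_weights_close [NeZero N] (W' : DvocReduced N) (hθ : W'.θ = W.θ) (hv : W'.vref = W.vref)
    (hα : W'.α = W.α) (hsym : ∀ k j, W.w k j = W.w j k) (hsym' : ∀ k j, W'.w k j = W'.w j k)
    (hvpos : ∀ k, 0 < W.vref k) {d ρ : ℝ} (hd : ∀ k, ∑ j, |W.w k j - W'.w k j| ≤ d)
    (hρ : ∀ j k, W.vref j / W.vref k ≤ ρ) (c : ℝ) (u : DvocState N) :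
    W'.kerForm (c + (3 + ρ) * d) u ≤ W.kerForm c u := by
  have h := W.abs_kerForm_sub_le W' hθ hv hα hsym hsym' hvpos hd hρ c u
  rw [W'.kerForm_add]
  have := (abs_le.mp h).1
  linarith

/-- **THE TRANSFERRED DOOR**: if the bracket record `W̃` (same `θ`, `v*`, `α`; symmetric weights within row-sum
distance `d` of `W`'s) satisfies `h_{c + (3+ρ)d}(u; w̃) ≥ 0` on `ker Sᵀ`, then `W.DecreaseOnS c` for the EXACT
record. [cite: GrossEtAl2019, Lemma 2 (23) and its proof (40)–(41)] -/
theorem decreaseOnS_of_kerForm_close [NeZero N] (W' : DvocReduced N) (hθ : W'.θ = W.θ) (hv : W'.vref = W.vref)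
    (hα : W'.α = W.α) (hsym : ∀ k j, W.w k j = W.w j k) (hsym' : ∀ k j, W'.w k j = W'.w j k)
    (hvpos : ∀ k, 0 < W.vref k) {d ρ : ℝ} (hd : ∀ k, ∑ j, |W.w k j - W'.w k j| ≤ d)
    (hρ : ∀ j k, W.vref j / W.vref k ≤ ρ) {c : ℝ}
    (h : ∀ u : DvocState N, W'.sig₁ u = 0 → W'.sig₂ u = 0 → 0 ≤ W'.kerForm (c + (3 + ρ) * d) u) :
    W.DecreaseOnS c := by
  refine W.decreaseOnS_of_kerForm hvpos fun u h1 h2 => ?_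
  obtain ⟨e1, e2⟩ := W.sig_eq_of_same_setpoints W' hθ hv u
  exact (h u (by rw [e1, h1]) (by rw [e2, h2])).trans
    (W.kerForm_ge_of_weights_close W' hθ hv hα hsym hsym' hvpos hd hρ c u)

/-! ## §5 Generic block: the bordered doors for ANY symmetric matrix representing a kernel form
(append 2026-08-28, same sources; for variants of the reduced model — e.g. per-edge rotated couplings — whose kernel
form is represented by a different `(2N) × (2N)` block than `hMatrix c`) -/

/-- **GENERIC NONPOSITIVE-COUNT DOOR**: if a symmetric `B` on `Fin N ⊕ Fin N` represents a form `Φ`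
(`(toVec u)ᵀ B (toVec u) = Φ u` for all `u`) and the bordered matrix `[B Σ; Σᵀ 0]` has at most two eigenvalues `≤ 0`,
then `Φ u ≥ 0` for every `u` with `Sᵀu = 0`.  (`B = hMatrix c`, `Φ = kerForm c` is §3; a rotated-coupling model
supplies its own `B`, `Φ`.) [cite: GrossEtAl2019, Lemma 2 (23) and its proof (40)–(41)]; [cite: Gould1985, Lemma 3.4] (via the tree) -/
theorem nonneg_on_kerSig_of_borderedNonposCount (B : Matrix (Fin N ⊕ Fin N) (Fin N ⊕ Fin N) ℝ)
    (Φ : DvocState N → ℝ) (hBΦ : ∀ u : DvocState N, toVec u ⬝ᵥ B *ᵥ toVec u = Φ u)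
    (hK : (Matrix.fromBlocks B W.sigMatrix (W.sigMatrix)ᵀ (0 : Matrix (Fin 2) (Fin 2) ℝ)).IsHermitian)
    (hle : (univ.filter fun i => hK.eigenvalues i ≤ 0).card ≤ 2) :
    ∀ u : DvocState N, W.sig₁ u = 0 → W.sig₂ u = 0 → 0 ≤ Φ u := by
  intro u h1 h2
  have hker : (W.sigMatrix)ᵀ *ᵥ toVec u = 0 := (W.sigMatrix_transpose_mulVec_eq_zero_iff u).2 ⟨h1, h2⟩
  by_cases hu : toVec u = 0
  · rw [← hBΦ u, hu]; simp
  · have h := Literature.LinearAlgebra.Matrix.BorderedHessianInertia.posDef_on_ker_of_bordered_nonposCount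
      W.sigMatrix hK (by simpa using hle) (toVec u) hker hu
    rw [hBΦ] at h
    exact h.le

/-- **GENERIC INERTIA + DETERMINANT DOOR**: same with «at most two negative eigenvalues and `det ≠ 0`».
[cite: GrossEtAl2019, Lemma 2 (23) and its proof (40)–(41)]; [cite: Gould1985, Lemma 3.4] (via the tree) -/
theorem nonneg_on_kerSig_of_borderedInertia (B : Matrix (Fin N ⊕ Fin N) (Fin N ⊕ Fin N) ℝ)
    (Φ : DvocState N → ℝ) (hBΦ : ∀ u : DvocState N, toVec u ⬝ᵥ B *ᵥ toVec u = Φ u)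
    (hK : (Matrix.fromBlocks B W.sigMatrix (W.sigMatrix)ᵀ (0 : Matrix (Fin 2) (Fin 2) ℝ)).IsHermitian)
    (hneg : (univ.filter fun i => hK.eigenvalues i < 0).card ≤ 2)
    (hdet : (Matrix.fromBlocks B W.sigMatrix (W.sigMatrix)ᵀ (0 : Matrix (Fin 2) (Fin 2) ℝ)).det ≠ 0) :
    ∀ u : DvocState N, W.sig₁ u = 0 → W.sig₂ u = 0 → 0 ≤ Φ u := by
  intro u h1 h2
  have hker : (W.sigMatrix)ᵀ *ᵥ toVec u = 0 := (W.sigMatrix_transpose_mulVec_eq_zero_iff u).2 ⟨h1, h2⟩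
  have h := Literature.LinearAlgebra.Matrix.BorderedHessianInertia.nonneg_on_ker_of_bordered_inertia
    W.sigMatrix hK (by simpa using hneg) hdet (toVec u) hker
  rwa [hBΦ] at h

/-- **GENERIC SHIFTED-CORNER DOOR**: same with `[B Σ; Σᵀ −δI₂]`, `δ > 0`, at most two negative eigenvalues
(the sparse negative-index certificate's form). [cite: GrossEtAl2019, Lemma 2 (23) and its proof (40)–(41)];
[cite: Gould1985, Lemma 3.4] (via the tree) -/
theorem nonneg_on_kerSig_of_shiftedBorderedNegIndex (B : Matrix (Fin N ⊕ Fin N) (Fin N ⊕ Fin N) ℝ)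
    (Φ : DvocState N → ℝ) (hBΦ : ∀ u : DvocState N, toVec u ⬝ᵥ B *ᵥ toVec u = Φ u) {δ : ℝ} (hδ : 0 < δ)
    (hK : (Matrix.fromBlocks B W.sigMatrix (W.sigMatrix)ᵀ (-(δ • (1 : Matrix (Fin 2) (Fin 2) ℝ)))).IsHermitian)
    (hneg : (univ.filter fun i => hK.eigenvalues i < 0).card ≤ 2) :
    ∀ u : DvocState N, W.sig₁ u = 0 → W.sig₂ u = 0 → 0 ≤ Φ u := by
  intro u h1 h2
  have hker : (W.sigMatrix)ᵀ *ᵥ toVec u = 0 := (W.sigMatrix_transpose_mulVec_eq_zero_iff u).2 ⟨h1, h2⟩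
  have h := Literature.LinearAlgebra.Matrix.BorderedHessianInertia.nonneg_on_ker_of_shiftedBordered_negIndex
    W.sigMatrix hδ hK (by simpa using hneg) (toVec u) hker
  rwa [hBΦ] at h

/-- **GENERIC DOOR INTO (23)**: any symmetric `B` DOMINATED by the kernel form (`(toVec u)ᵀB(toVec u) ≤ h_c(u)`,
e.g. `B = hMatrix c` with equality, or a certified minorant) whose bordered matrix passes one of the three tests
gives `W.DecreaseOnS c`. [cite: GrossEtAl2019, Lemma 2 (23) and its proof (40)–(41)] -/
theorem decreaseOnS_of_block_le_kerForm [NeZero N] (hv : ∀ k, 0 < W.vref k) (c : ℝ)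
    (B : Matrix (Fin N ⊕ Fin N) (Fin N ⊕ Fin N) ℝ) (hB : ∀ u : DvocState N, toVec u ⬝ᵥ B *ᵥ toVec u ≤ W.kerForm c u)
    (hpos : ∀ u : DvocState N, W.sig₁ u = 0 → W.sig₂ u = 0 → 0 ≤ toVec u ⬝ᵥ B *ᵥ toVec u) :
    W.DecreaseOnS c :=
  W.decreaseOnS_of_kerForm hv fun u h1 h2 => (hpos u h1 h2).trans (hB u)

end DvocReduced

end Literature.MathematicalPhysics.PowerSystems

end
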